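import Summits.AtomisticToContinuum.Crystallization.Theorems.ChargedEnergyGapChartDialQ
import Summits.AtomisticToContinuum.Crystallization.Theorems.ChargedEnergyGapChartDialU

/-!
# `ChargedEnergyGap` · the CHART DIAL, part W: THE INNER-PRODUCT DICTIONARY OF A SCALE-FREE DOZEN
(decomp-a2c lens-3 g39 node «ChargeFreeGap»; fourth input of the [G] port plan, after parts T, U, V)

The landed gapped fan machine (`GappedShellCensusShellTrichotomyStub{OriginInterior, FanStruct, FanAngles}`)
works, after its private dictionary `shell_facts`, ENTIRELY with the radially normalised code
`u k := ‖t k‖⁻¹ • t k` and three facts: `‖u k‖ = 1`; `⟪u k, u l⟫ ≤ 2801/5202 ≈ 0·5385` for `k ≠ l`;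
`2201/4802 ≈ 0·4584 ≤ ⟪u k, u l⟫` for bonded `k, l`; plus injectivity of `u` and "four bonds per label".
This file proves EXACTLY these facts for a SCALE-FREE DOZEN `IsScaleFreeDozen t b` (part Q), with the SAME two
constants, so that the abstract parts of the gapped machine can be re-run verbatim with `bond := b`:

* `IsScaleFreeDozen.inner_normalize_le` — all pairs: `⟪u k, u l⟫ ≤ 2801/5202`, from (R1) + (R2) via part T's
  scale-free upper window `cos_upper` (normalised cosine `≤ 5201/10201 ≈ 0·5099 ≤ 0·5385`);
* `IsScaleFreeDozen.le_inner_normalize` — bonds: `2201/4802 ≤ ⟪u k, u l⟫`, from (R1) + (R4) via `cos_lower`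
  (`≥ 9799/20000 ≈ 0·48995 ≥ 0·4584`);
* `IsScaleFreeDozen.norm_normalize`, `.normalize_injective`, `.card_filter_bond` (`= 4`, classical filter), and the
  (R1)/(R2)/(R4) projections in the shape consumed by parts T/U (`tCorner_le`, `halfCorner_le`, `qCorner_le`).

No `sorry`, no new axiom, no instance / notation / option; no new definitions.
-/

noncomputable section

open scoped RealInnerProductSpace
open Literature.MathematicalPhysics.StatisticalMechanics
open Literature.Geometry.DiscreteGeometry
open Literature.Geometry.DiscreteGeometry.ShellCensus
open Summit.AtomisticToContinuum.Crystallization.Theses.PricedLinkCensus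
open Summit.AtomisticToContinuum.Crystallization.Theorems.ChargedEnergyGapNegative

namespace Summit.AtomisticToContinuum.Crystallization.Theorems.ChargedEnergyGapChartDial

/-! ## §1 Projections of the scale-free axioms -/

namespace IsScaleFreeDozen

variable {t : Fin 12 → E3} {b : Fin 12 → Fin 12 → Prop}

/-- Field accessor / elementary consequence of `IsScaleFreeDozen` (`one_le_norm`). -/
theorem one_le_norm (hD : IsScaleFreeDozen t b) (k : Fin 12) : 1 ≤ ‖t k‖ := (hD.1 k).1

/-- Field accessor / elementary consequence of `IsScaleFreeDozen` (`norm_le`). -/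
theorem norm_le (hD : IsScaleFreeDozen t b) (k : Fin 12) : ‖t k‖ ≤ 101 / 100 := (hD.1 k).2

/-- Field accessor / elementary consequence of `IsScaleFreeDozen` (`norm_pos`). -/
theorem norm_pos (hD : IsScaleFreeDozen t b) (k : Fin 12) : 0 < ‖t k‖ := by linarith [hD.one_le_norm k]

/-- (R2): every radius is at most `1·01` times every distance. -/
theorem norm_le_dist (hD : IsScaleFreeDozen t b) {i j : Fin 12} (hij : i ≠ j) :
    ‖t i‖ ≤ 101 / 100 * dist (t i) (t j) := hD.2.1 i j hij

/-- (R2), far endpoint. -/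
theorem norm_le_dist' (hD : IsScaleFreeDozen t b) {i j : Fin 12} (hij : i ≠ j) :
    ‖t j‖ ≤ 101 / 100 * dist (t i) (t j) := by
  rw [dist_comm]; exact hD.2.1 j i hij.symm

/-- Field accessor / elementary consequence of `IsScaleFreeDozen` (`symm`). -/
theorem symm (hD : IsScaleFreeDozen t b) {i j : Fin 12} (h : b i j) : b j i := hD.2.2.1 i j h

/-- Field accessor / elementary consequence of `IsScaleFreeDozen` (`irrefl`). -/
theorem irrefl (hD : IsScaleFreeDozen t b) (i : Fin 12) : ¬ b i i := hD.2.2.2.1 i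

/-- Field accessor / elementary consequence of `IsScaleFreeDozen` (`ne_of_bond`). -/
theorem ne_of_bond (hD : IsScaleFreeDozen t b) {i j : Fin 12} (h : b i j) : i ≠ j :=
  fun hij => hD.irrefl j (hij ▸ h)

/-- Field accessor / elementary consequence of `IsScaleFreeDozen` (`ncard_bond`). -/
theorem ncard_bond (hD : IsScaleFreeDozen t b) (i : Fin 12) : {j : Fin 12 | b i j}.ncard = 4 := hD.2.2.2.2.1 i

/-- (R4): a bond is at most `1·01` times the radius of either endpoint. -/
theorem dist_le_norm (hD : IsScaleFreeDozen t b) {i j : Fin 12} (h : b i j) :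
    dist (t i) (t j) ≤ 101 / 100 * ‖t i‖ := (hD.2.2.2.2.2.1 i j h).1

/-- Field accessor / elementary consequence of `IsScaleFreeDozen` (`dist_le_norm'`). -/
theorem dist_le_norm' (hD : IsScaleFreeDozen t b) {i j : Fin 12} (h : b i j) :
    dist (t i) (t j) ≤ 101 / 100 * ‖t j‖ := by
  rw [dist_comm]; exact (hD.2.2.2.2.2.1 j i (hD.symm h)).1

/-- (R4): a bond is at most `1·01` times any other distance from either endpoint. -/
theorem dist_le_dist (hD : IsScaleFreeDozen t b) {i j k : Fin 12} (h : b i j) (hk : k ≠ i) :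
    dist (t i) (t j) ≤ 101 / 100 * dist (t i) (t k) := (hD.2.2.2.2.2.1 i j h).2 k hk

/-! ## §2 The normalised code -/

/-- The radial projection of a scale-free dozen lies on the unit sphere. -/
theorem norm_normalize (hD : IsScaleFreeDozen t b) (k : Fin 12) : ‖‖t k‖⁻¹ • t k‖ = 1 := by
  rw [norm_smul, norm_inv, norm_norm, inv_mul_cancel₀ (hD.norm_pos k).ne']

/-- The cosine between two directions in terms of the points. -/
theorem inner_normalize_eq {a c : E3} (ha : 0 < ‖a‖) (hc : 0 < ‖c‖) :
    ⟪‖a‖⁻¹ • a, ‖c‖⁻¹ • c⟫ = ⟪a, c⟫ / (‖a‖ * ‖c‖) := by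
  rw [real_inner_smul_left, real_inner_smul_right]
  field_simp

/-- **All pairs**: two directions of a scale-free dozen have cosine `≤ 2801/5202` (in fact `≤ 5201/10201`, part T's
upper window from (R1) + (R2)). -/
theorem inner_normalize_le (hD : IsScaleFreeDozen t b) {k l : Fin 12} (hkl : k ≠ l) :
    ⟪‖t k‖⁻¹ • t k, ‖t l‖⁻¹ • t l⟫ ≤ 2801 / 5202 := by
  have hk := hD.norm_pos k
  have hl := hD.norm_pos l
  rw [inner_normalize_eq hk hl, div_le_iff₀ (mul_pos hk hl)]
  have g : ⟪t k, t l⟫ = (‖t k‖ ^ 2 + ‖t l‖ ^ 2 - dist (t k) (t l) ^ 2) / 2 := by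
    rw [dist_eq_norm, norm_sub_sq_real]; ring
  have h := cos_upper (hD.one_le_norm k) (hD.norm_le k) (hD.one_le_norm l) (hD.norm_le l) (hD.norm_le_dist hkl)
    (hD.norm_le_dist' hkl)
  rw [← g] at h
  have hX : (5201 / 10201 : ℝ) * (‖t k‖ * ‖t l‖) ≤ 2801 / 5202 * (‖t k‖ * ‖t l‖) :=
    mul_le_mul_of_nonneg_right (by norm_num) (mul_pos hk hl).le
  linarith

/-- **Bonds**: two bonded directions have cosine `≥ 2201/4802` (in fact `≥ 9799/20000`, part T's lower window from
(R1) + (R4)). -/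
theorem le_inner_normalize (hD : IsScaleFreeDozen t b) {k l : Fin 12} (hb : b k l) :
    2201 / 4802 ≤ ⟪‖t k‖⁻¹ • t k, ‖t l‖⁻¹ • t l⟫ := by
  have hk := hD.norm_pos k
  have hl := hD.norm_pos l
  rw [inner_normalize_eq hk hl, le_div_iff₀ (mul_pos hk hl)]
  have g : ⟪t k, t l⟫ = (‖t k‖ ^ 2 + ‖t l‖ ^ 2 - dist (t k) (t l) ^ 2) / 2 := by
    rw [dist_eq_norm, norm_sub_sq_real]; ring
  have h := cos_lower hk.le hl.le dist_nonneg (hD.dist_le_norm hb) (hD.dist_le_norm' hb)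
  rw [← g] at h
  have hZ : (2201 / 4802 : ℝ) * (‖t k‖ * ‖t l‖) ≤ 9799 / 20000 * (‖t k‖ * ‖t l‖) :=
    mul_le_mul_of_nonneg_right (by norm_num) (mul_pos hk hl).le
  linarith

/-- The radial projection of a scale-free dozen is injective. -/
theorem normalize_injective (hD : IsScaleFreeDozen t b) : Function.Injective fun k => ‖t k‖⁻¹ • t k := by
  intro k l hkl
  by_contra hne
  have h := hD.inner_normalize_le hne
  have hkl' : ‖t k‖⁻¹ • t k = ‖t l‖⁻¹ • t l := hkl
  rw [hkl', real_inner_self_eq_norm_sq, hD.norm_normalize l] at h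
  norm_num at h

/-- A scale-free dozen is injective. -/
theorem injective (hD : IsScaleFreeDozen t b) : Function.Injective t := by
  intro k l hkl
  exact hD.normalize_injective (by simp only [hkl])

/-- Four bonds per label, as a (classical) filter cardinality. -/
theorem card_filter_bond (hD : IsScaleFreeDozen t b) [DecidableRel b] (k : Fin 12) :
    (Finset.univ.filter fun l => b k l).card = 4 := by
  have h := hD.ncard_bond k
  rw [← h, ← Set.ncard_coe_finset]
  congr 1
  ext l
  simp

/-- The same with the (redundant) clause `l ≠ k`, the shape used by the gapped fan machine. -/
theorem card_filter_ne_bond (hD : IsScaleFreeDozen t b) [DecidableRel b] (k : Fin 12) :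
    (Finset.univ.filter fun l => l ≠ k ∧ b k l).card = 4 := by
  rw [← hD.card_filter_bond k]
  congr 1
  ext l
  simp only [Finset.mem_filter, Finset.mem_univ, true_and, and_iff_right_iff_imp]
  exact fun h => (hD.ne_of_bond h).symm

/-! ## §3 The corner bounds of parts T/U over a scale-free dozen -/

/-- **T-corner of a scale-free dozen**: for bonds `v a`, `v b`, `a b`. -/
theorem tCorner (hD : IsScaleFreeDozen t b) {v a c : Fin 12} (hva : b v a) (hvc : b v c) (hac : b a c) :
    InnerProductGeometry.angle (perpTo (t v) (t a)) (perpTo (t v) (t c)) ≤ Real.arccos (31 / 100) :=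
  tCorner_le (t v) (t a) (t c) (hD.one_le_norm v) (hD.norm_le v) (hD.one_le_norm a) (hD.norm_le a)
    (hD.one_le_norm c) (hD.norm_le c) (hD.norm_le_dist (hD.ne_of_bond hva)) (hD.norm_le_dist (hD.ne_of_bond hvc))
    (hD.norm_le_dist' (hD.ne_of_bond hva)) (hD.norm_le_dist (hD.ne_of_bond hac))
    (hD.norm_le_dist' (hD.ne_of_bond hvc)) (hD.norm_le_dist' (hD.ne_of_bond hac)) (hD.dist_le_norm hva)
    (hD.dist_le_norm' hva) (hD.dist_le_norm hvc) (hD.dist_le_norm' hvc) (hD.dist_le_norm hac) (hD.dist_le_norm' hac)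

/-- **Half-quad corner of a scale-free dozen**: bonds `v a`, `a x`; the pair `v x` only needs `v ≠ x`. -/
theorem hCorner (hD : IsScaleFreeDozen t b) {v a x : Fin 12} (hva : b v a) (hax : b a x) (hvx : v ≠ x) :
    InnerProductGeometry.angle (perpTo (t v) (t a)) (perpTo (t v) (t x)) ≤ Real.arccos (31 / 100) :=
  halfCorner_le (t v) (t a) (t x) (hD.one_le_norm v) (hD.norm_le v) (hD.one_le_norm a) (hD.norm_le a)
    (hD.one_le_norm x) (hD.norm_le x) (hD.norm_le_dist (hD.ne_of_bond hva)) (hD.norm_le_dist hvx)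
    (hD.norm_le_dist' (hD.ne_of_bond hva)) (hD.norm_le_dist (hD.ne_of_bond hax)) (hD.norm_le_dist' hvx)
    (hD.norm_le_dist' (hD.ne_of_bond hax)) (hD.dist_le_norm hva) (hD.dist_le_norm' hva) (hD.dist_le_norm hax)
    (hD.dist_le_norm' hax)

/-- **Quad corner of a scale-free dozen**: bonds `v d`, `v a`, `d x`, `a x`; the diagonal `v x` only needs `v ≠ x`. -/
theorem qCorner (hD : IsScaleFreeDozen t b) {v d a x : Fin 12} (hvd : b v d) (hva : b v a) (hdx : b d x)
    (hax : b a x) (hvx : v ≠ x) :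
    InnerProductGeometry.angle (perpTo (t v) (t d)) (perpTo (t v) (t a)) ≤ 2 * Real.arccos (31 / 100) :=
  qCorner_le (t v) (t d) (t a) (t x) (hD.one_le_norm v) (hD.norm_le v) (hD.one_le_norm d) (hD.norm_le d)
    (hD.one_le_norm a) (hD.norm_le a) (hD.one_le_norm x) (hD.norm_le x) (hD.norm_le_dist (hD.ne_of_bond hvd))
    (hD.norm_le_dist' (hD.ne_of_bond hvd)) (hD.norm_le_dist (hD.ne_of_bond hva)) (hD.norm_le_dist' (hD.ne_of_bond hva))
    (hD.norm_le_dist hvx) (hD.norm_le_dist' hvx) (hD.norm_le_dist (hD.ne_of_bond hdx))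
    (hD.norm_le_dist' (hD.ne_of_bond hdx)) (hD.norm_le_dist (hD.ne_of_bond hax)) (hD.norm_le_dist' (hD.ne_of_bond hax))
    (hD.dist_le_norm hvd) (hD.dist_le_norm' hvd) (hD.dist_le_norm hva) (hD.dist_le_norm' hva) (hD.dist_le_norm hdx)
    (hD.dist_le_norm' hdx) (hD.dist_le_norm hax) (hD.dist_le_norm' hax)

end IsScaleFreeDozen

end Summit.AtomisticToContinuum.Crystallization.Theorems.ChargedEnergyGapChartDial

end
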